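import Mathlib.Data.Finset.Powerset
import Mathlib.Data.Finset.Card
import Mathlib.Data.Fintype.Fin
import Mathlib.Algebra.BigOperators.Group.Finset.Basic
import Mathlib.Algebra.BigOperators.Fin
import Mathlib.Algebra.Order.BigOperators.Group.Finset
import Mathlib.Data.Set.Pairwise.Lattice
import Mathlib.Tactic.Linarith
import Mathlib.Tactic.Ring
import Mathlib.Tactic.FinCases
import Mathlib.Tactic.Choose
import HarnessLib

/-!
# Pratt's reduction from `s`-Set Cover to Balanced Tripartitioning: the combinatorics

Topic `Computability/FineGrained`. K. Pratt, *A stronger connection between the asymptotic rank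
conjecture and the set cover conjecture*, Proc. 56th STOC (2024), arXiv:2311.02774 [Pratt2024SCC],
proof of Corollary 1.10 (pp. 6–7 of the arXiv version), reduces `s`-Set Cover (Problem 1.1) on the
universe `[n]` to `poly(n)` instances of Balanced Tripartitioning (Problem 1.3) on universes
`[n] ∖ S`, `|S| = 3s`, after a `binom(n, n/3) · poly(n)`-time dynamic programme. Run under the Set
Cover Conjecture, the same reduction is the "hardness half" of Corollaries 1.11 and 1.12
(`Literature.Computability.AlgebraicComplexity.pratt2024_cor_1_12_of_hardness`, whose hypothesis
`SetCoverConjecture → ∀ c < 8, ¬ BalancedTripartitioning ∈ RandTIME O(c^n)` it is meant to prove).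

This file PROVES the machine-free content of that reduction — everything in Pratt's three
paragraphs that is a statement about finite set families rather than about running times — over
an arbitrary ground finset `U` of a type with decidable equality:

* `downwardClosure` (`𝓕' := ⋃_{X ∈ 𝓕} 2^X`), `card_downwardClosure_le` (`|𝓕'| ≤ |𝓕| 2^s`), and
  **`exists_cover_iff_exists_partition`**: "`𝓕` contains at most `t` sets covering `[n]` if and
  only if `𝓕'` contains at most `t` sets partitioning `[n]`" (disjointification /
  choice of supersets).
* `disjointUnions 𝓓 b m` — the dynamic programme "compute all unions of all pairwise disjoint
  collections of `m` subsets in `𝓕'`, having size at most `n/3 + s`" as a recursion on `m`, with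
  soundness and completeness (`exists_family_of_mem_disjointUnions`,
  `biUnion_mem_disjointUnions`, `exists_mem_disjointUnions_iff`) and the a-priori bound
  `disjointUnions_subset_filter_powerset` (each layer lies in `{A ⊆ U : |A| ≤ b}`).
* **`exists_balanced_colouring`**: "for any partition `X_1 ⊔ ⋯ ⊔ X_m = [n]` with `|X_i| ≤ s`
  there exists a partition `A ⊔ B ⊔ C = [m]` such that `⌊n/3⌋ − s ≤ |⊔_{a∈A} X_a| ≤ ⌊n/3⌋ + s`,
  and similarly for `B` and `C`" — for `n = 3q`, proved by the greedy rule "put the next part into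
  a smallest class" (`exists_colouring_card_le_card_add`: the three classes stay within `s` of
  each other), which the source leaves to the reader.
* `prattLayer` (`𝓕'_m`, with the lower size cut-off `≥ q − s`), `boundaryFamily`
  (`𝓕''_{m,S} = {X ∖ S_i : X ∈ 𝓕'_m, |X| = n/3 − s + |S_i|, X ∩ S = S_i}`), whose members are
  `(q − s)`-subsets of `U ∖ S` (`card_of_mem_boundaryFamily`, `subset_sdiff_of_mem_boundaryFamily`),
  and the **main equivalence** `exists_cover_iff_exists_boundary_tripartition`: for a family of
  `≤ s`-subsets of a `3q`-set `U` (`s ≤ q`), at most `t` of them cover `U` iff for some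
  `t₀ + t₁ + t₂ ≤ t` and some `3s`-set `S = S₀ ⊔ S₁ ⊔ S₂ ⊆ U` the families
  `𝓕''_{t₀,S}, 𝓕''_{t₁,S}, 𝓕''_{t₂,S}` contain a balanced tripartition of `U ∖ S` ("If there were
  sets in `𝓕'_{t_1}, 𝓕'_{t_2}, 𝓕'_{t_3}` partitioning `[n]`, then there exists an `S` such that
  … contains a balanced tripartition of `[n] ∖ S`, and conversely").

## Design choices

* `n = 3q` and `s ≤ q` are hypotheses (the source silently assumes `3 ∣ n` when it speaks of
  "size `n/3 − s`"; an `s`-Set Cover instance is padded to the next multiple of `3` by dummy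
  elements covered by forced singletons, and instances with `n < 3s` are of constant size —
  both are bookkeeping for the word-RAM programme, not for this file). The lower window bound
  `q − s ≤ |X|` is written `q ≤ |X| + s`; the target size `q − s` uses `ℕ`-subtraction under
  `s ≤ q`.
* Families and classes indexed by `Fin 3` (`m`, `S_i =: B i`, `Y i`) rather than three named
  sets, so that sums are `Fin.sum_univ_three`; "pairwise disjoint with union `V`" is spelled out
  (`∀ i j, i ≠ j → Disjoint …` and `Finset.univ.biUnion Y = V`).
* No `Prop`-valued definitions: the cover / partition predicates are written out in each
  statement (`∃ G ⊆ 𝓕, |G| ≤ t ∧ U ⊆ ⋃ G`), in the shape of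
  `SetCoverInstance.HasCoverWithin` unfolded over the instance's set family.

## What is NOT here

Anything about machines or running times: the word-RAM programme implementing the dynamic
programme in time `binom(n, ⌊n/3⌋ + s) · poly(n)`, its calls to a Balanced Tripartitioning
subroutine with success amplification, and the exponent bookkeeping
(`c^{n/3} · poly(n) ≤ 2^{(1−δ)n}` for `c < 8`) — i.e. the proof of the hardness hypothesis of
`pratt2024_cor_1_12_of_hardness` itself — and Theorem 1.9 (`pratt2024_thm_1_9`). The glue to the
tree's problem statements `FineGrained.SetCover s` / `FineGrained.BalancedTripartitioning`
(instances as lists) is kept out of this import-light file.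

## References

* [Pratt2024SCC] K. Pratt, STOC 2024, doi:10.1145/3618260.3649620, arXiv:2311.02774 — Problem 1.1,
  Problem 1.3, Cor. 1.10 and its proof (§2, pp. 6–7).
-/

namespace Literature.Computability.FineGrained

variable {α : Type*} [DecidableEq α]

/-! ## Downward closure: covers versus partitions -/

/-- The downward closure `𝓕' = ⋃_{X ∈ 𝓕} 2^X` of a finite set family (Pratt, proof of Cor. 1.10:
"first construct its downwards closure"). [cite: Pratt2024SCC, Cor. 1.10 (proof)] -/
def downwardClosure (F : Finset (Finset α)) : Finset (Finset α) :=
  F.biUnion Finset.powerset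

/-- Membership in the downward closure. [cite: Pratt2024SCC, Cor. 1.10 (proof)] -/
theorem mem_downwardClosure {F : Finset (Finset α)} {Y : Finset α} :
    Y ∈ downwardClosure F ↔ ∃ X ∈ F, Y ⊆ X := by
  simp [downwardClosure]

/-- Subsets of members are in the downward closure. [folklore] -/
theorem mem_downwardClosure_of_subset {F : Finset (Finset α)} {X Y : Finset α} (hX : X ∈ F)
    (hYX : Y ⊆ X) : Y ∈ downwardClosure F :=
  mem_downwardClosure.2 ⟨X, hX, hYX⟩

/-- The downward closure is monotone. [folklore] -/
theorem downwardClosure_mono {F F' : Finset (Finset α)} (h : F ⊆ F') :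
    downwardClosure F ⊆ downwardClosure F' := fun _ hY => by
  obtain ⟨X, hX, hYX⟩ := mem_downwardClosure.1 hY
  exact mem_downwardClosure_of_subset (h hX) hYX

/-- The downward closure of a family of subsets of `U` consists of subsets of `U`. [folklore] -/
theorem downwardClosure_subset_powerset {F : Finset (Finset α)} {U : Finset α}
    (hF : F ⊆ U.powerset) : downwardClosure F ⊆ U.powerset := fun _ hY => by
  obtain ⟨X, hX, hYX⟩ := mem_downwardClosure.1 hY
  exact Finset.mem_powerset.2 (hYX.trans (Finset.mem_powerset.1 (hF hX)))

/-- Members of the downward closure of a family of `≤ s`-sets have at most `s` elements.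
[folklore] -/
theorem card_le_of_mem_downwardClosure {F : Finset (Finset α)} {s : ℕ} (hs : ∀ X ∈ F, X.card ≤ s)
    {Y : Finset α} (hY : Y ∈ downwardClosure F) : Y.card ≤ s := by
  obtain ⟨X, hX, hYX⟩ := mem_downwardClosure.1 hY
  exact (Finset.card_le_card hYX).trans (hs X hX)

/-- `|𝓕'| ≤ |𝓕| · 2^s` for a family of `≤ s`-sets ("This is done in time `|𝓕| · poly(n)`" for
fixed `s`). [cite: Pratt2024SCC, Cor. 1.10 (proof)] -/
theorem card_downwardClosure_le {F : Finset (Finset α)} {s : ℕ} (hs : ∀ X ∈ F, X.card ≤ s) :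
    (downwardClosure F).card ≤ F.card * 2 ^ s := by
  unfold downwardClosure
  calc (F.biUnion Finset.powerset).card ≤ ∑ X ∈ F, X.powerset.card := Finset.card_biUnion_le
    _ ≤ ∑ X ∈ F, 2 ^ s := Finset.sum_le_sum fun X hX => by
        rw [Finset.card_powerset]
        exact Nat.pow_le_pow_right (by norm_num) (hs X hX)
    _ = F.card * 2 ^ s := by rw [Finset.sum_const, smul_eq_mul]

/-- Disjointification: the union of any finite family `𝓖` is partitioned by at most `|𝓖|`
pairwise disjoint members of its downward closure (`X_i ∖ (X_1 ∪ … ∪ X_{i-1})`). [folklore] -/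
theorem exists_pairwiseDisjoint_downwardClosure (G : Finset (Finset α)) :
    ∃ P ⊆ downwardClosure G, P.card ≤ G.card ∧ (P : Set (Finset α)).PairwiseDisjoint id ∧
      P.biUnion id = G.biUnion id := by
  induction G using Finset.induction_on with
  | empty => exact ⟨∅, by simp, by simp, by simp, by simp⟩
  | insert X G₀ hX ih =>
    obtain ⟨P₀, hP₀, hcard, hPD, hU⟩ := ih
    refine ⟨insert (X \ G₀.biUnion id) P₀, ?_, ?_, ?_, ?_⟩
    · refine Finset.insert_subset ?_ (hP₀.trans (downwardClosure_mono (Finset.subset_insert _ _)))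
      exact mem_downwardClosure_of_subset (Finset.mem_insert_self _ _) Finset.sdiff_subset
    · rw [Finset.card_insert_of_notMem hX]
      exact (Finset.card_insert_le _ _).trans (by omega)
    · rw [Finset.coe_insert]
      refine hPD.insert fun Z hZ _ => ?_
      have hZ' : Z ⊆ G₀.biUnion id := by
        rw [← hU]; exact Finset.subset_biUnion_of_mem id (by exact_mod_cast hZ)
      exact Finset.sdiff_disjoint.mono_right hZ'
    · rw [Finset.biUnion_insert, Finset.biUnion_insert, hU]
      simp [Finset.sdiff_union_self_eq_union]

/-- **Cover ↔ partition** (Pratt, proof of Cor. 1.10: "`𝓕` contains at most `t` sets covering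
`[n]` if and only if `𝓕'` contains at most `t` sets partitioning `[n]`"), for a family `𝓕` of
subsets of `U`: at most `t` sets of `𝓕` cover `U` iff at most `t` pairwise disjoint sets of the
downward closure `𝓕'` have union exactly `U`. [cite: Pratt2024SCC, Cor. 1.10 (proof)] -/
theorem exists_cover_iff_exists_partition {F : Finset (Finset α)} {U : Finset α}
    (hF : F ⊆ U.powerset) (t : ℕ) :
    (∃ G ⊆ F, G.card ≤ t ∧ U ⊆ G.biUnion id) ↔
      ∃ G ⊆ downwardClosure F, G.card ≤ t ∧ (G : Set (Finset α)).PairwiseDisjoint id ∧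
        G.biUnion id = U := by
  constructor
  · rintro ⟨G, hGF, hGt, hUG⟩
    obtain ⟨P, hP, hcard, hPD, hPU⟩ := exists_pairwiseDisjoint_downwardClosure G
    refine ⟨P, hP.trans (downwardClosure_mono hGF), hcard.trans hGt, hPD, ?_⟩
    rw [hPU]
    refine Finset.Subset.antisymm ?_ hUG
    exact Finset.biUnion_subset.2 fun X hX => Finset.mem_powerset.1 (hF (hGF hX))
  · rintro ⟨P, hP, hcard, -, hPU⟩
    have hpar : ∀ Y ∈ P, ∃ X ∈ F, Y ⊆ X := fun Y hY => mem_downwardClosure.1 (hP hY)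
    choose! par hparF hparS using hpar
    refine ⟨P.image par, Finset.image_subset_iff.2 hparF, Finset.card_image_le.trans hcard, ?_⟩
    intro x hx
    rw [← hPU, Finset.mem_biUnion] at hx
    obtain ⟨Y, hY, hxY⟩ := hx
    exact Finset.mem_biUnion.2 ⟨par Y, Finset.mem_image_of_mem par hY, hparS Y hY hxY⟩

/-! ## The dynamic programme: unions of `m` pairwise disjoint sets of bounded size -/

/-- Pratt's dynamic-programming layers: `disjointUnions 𝓓 b m` is the family of unions of `m`
pairwise disjoint sets of `𝓓` all of whose partial unions have at most `b` elements
(`U₀ = {∅}`, `U_{m+1} = {A ∪ Y : A ∈ U_m, Y ∈ 𝓓, A ∩ Y = ∅, |A ∪ Y| ≤ b}`; "for each `m ≤ t`,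
compute all unions of all pairwise disjoint collections of `m` subsets in `𝓕'`, having size at
most `n/3 + s`. This can be done with dynamic programming").
[cite: Pratt2024SCC, Cor. 1.10 (proof)] -/
def disjointUnions (D : Finset (Finset α)) (b : ℕ) : ℕ → Finset (Finset α)
  | 0 => {∅}
  | m + 1 =>
    ((disjointUnions D b m ×ˢ D).filter fun p => Disjoint p.1 p.2 ∧ (p.1 ∪ p.2).card ≤ b).image
      fun p => p.1 ∪ p.2

/-- Layer `0` is `{∅}`. [folklore] -/
@[simp] theorem disjointUnions_zero (D : Finset (Finset α)) (b : ℕ) :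
    disjointUnions D b 0 = {∅} := rfl

/-- Membership in layer `m + 1`. [folklore] -/
theorem mem_disjointUnions_succ {D : Finset (Finset α)} {b m : ℕ} {A : Finset α} :
    A ∈ disjointUnions D b (m + 1) ↔
      ∃ B ∈ disjointUnions D b m, ∃ Y ∈ D, Disjoint B Y ∧ (B ∪ Y).card ≤ b ∧ B ∪ Y = A := by
  simp only [disjointUnions, Finset.mem_image, Finset.mem_filter, Finset.mem_product, Prod.exists]
  constructor
  · rintro ⟨B, Y, ⟨⟨hB, hY⟩, hd, hc⟩, rfl⟩
    exact ⟨B, hB, Y, hY, hd, hc, rfl⟩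
  · rintro ⟨B, hB, Y, hY, hd, hc, rfl⟩
    exact ⟨B, Y, ⟨⟨hB, hY⟩, hd, hc⟩, rfl⟩

/-- Every set in a layer has at most `b` elements. [folklore] -/
theorem card_le_of_mem_disjointUnions {D : Finset (Finset α)} {b : ℕ} :
    ∀ {m : ℕ} {A : Finset α}, A ∈ disjointUnions D b m → A.card ≤ b
  | 0, A, h => by
    rw [disjointUnions_zero, Finset.mem_singleton] at h
    simp [h]
  | m + 1, A, h => by
    obtain ⟨B, -, Y, -, -, hc, rfl⟩ := mem_disjointUnions_succ.1 h
    exact hc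

/-- Layers of a family of subsets of `U` consist of subsets of `U`. [folklore] -/
theorem subset_of_mem_disjointUnions {D : Finset (Finset α)} {U : Finset α} (hD : D ⊆ U.powerset)
    {b : ℕ} : ∀ {m : ℕ} {A : Finset α}, A ∈ disjointUnions D b m → A ⊆ U
  | 0, A, h => by
    rw [disjointUnions_zero, Finset.mem_singleton] at h
    simp [h]
  | m + 1, A, h => by
    obtain ⟨B, hB, Y, hY, -, -, rfl⟩ := mem_disjointUnions_succ.1 h
    exact Finset.union_subset (subset_of_mem_disjointUnions hD hB) (Finset.mem_powerset.1 (hD hY))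

/-- Hence a layer has at most as many members as `U` has subsets of size `≤ b`. [folklore] -/
theorem disjointUnions_subset_filter_powerset {D : Finset (Finset α)} {U : Finset α}
    (hD : D ⊆ U.powerset) (b m : ℕ) :
    disjointUnions D b m ⊆ U.powerset.filter fun A => A.card ≤ b := fun _ hA =>
  Finset.mem_filter.2
    ⟨Finset.mem_powerset.2 (subset_of_mem_disjointUnions hD hA), card_le_of_mem_disjointUnions hA⟩

/-- Soundness of the dynamic programme: a member of layer `m` is the union of at most `m`
pairwise disjoint sets of `𝓓`. [cite: Pratt2024SCC, Cor. 1.10 (proof)] -/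
theorem exists_family_of_mem_disjointUnions {D : Finset (Finset α)} {b : ℕ} :
    ∀ {m : ℕ} {A : Finset α}, A ∈ disjointUnions D b m →
      ∃ G ⊆ D, G.card ≤ m ∧ (G : Set (Finset α)).PairwiseDisjoint id ∧ G.biUnion id = A
  | 0, A, h => by
    rw [disjointUnions_zero, Finset.mem_singleton] at h
    exact ⟨∅, by simp, by simp, by simp, by simp [h]⟩
  | m + 1, A, h => by
    obtain ⟨B, hB, Y, hY, hd, -, rfl⟩ := mem_disjointUnions_succ.1 h
    obtain ⟨G₀, hG₀, hcard, hPD, hU⟩ := exists_family_of_mem_disjointUnions hB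
    refine ⟨insert Y G₀, Finset.insert_subset hY hG₀, (Finset.card_insert_le _ _).trans (by omega),
      ?_, ?_⟩
    · rw [Finset.coe_insert]
      refine hPD.insert fun Z hZ _ => ?_
      have hZ' : Z ⊆ B := by
        rw [← hU]; exact Finset.subset_biUnion_of_mem id (by exact_mod_cast hZ)
      exact (hd.mono_left hZ').symm
    · rw [Finset.biUnion_insert, hU, Finset.union_comm]
      rfl

/-- Completeness of the dynamic programme: the union of a pairwise disjoint subfamily
`𝓖 ⊆ 𝓓` with `|⋃ 𝓖| ≤ b` lies in layer `|𝓖|` (partial unions only grow).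
[cite: Pratt2024SCC, Cor. 1.10 (proof)] -/
theorem biUnion_mem_disjointUnions {D : Finset (Finset α)} {b : ℕ} {G : Finset (Finset α)}
    (hG : G ⊆ D) (hPD : (G : Set (Finset α)).PairwiseDisjoint id) (hb : (G.biUnion id).card ≤ b) :
    G.biUnion id ∈ disjointUnions D b G.card := by
  induction G using Finset.induction_on with
  | empty => simp
  | insert Y G₀ hY ih =>
    rw [Finset.coe_insert, Set.pairwiseDisjoint_insert_of_notMem (by exact_mod_cast hY)] at hPD
    rw [Finset.biUnion_insert] at hb ⊢
    rw [Finset.card_insert_of_notMem hY, mem_disjointUnions_succ]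
    have hG₀ : G₀ ⊆ D := (Finset.subset_insert _ _).trans hG
    have hd : Disjoint (G₀.biUnion id) Y := by
      rw [Finset.disjoint_biUnion_left]
      exact fun Z hZ => (hPD.2 Z (by exact_mod_cast hZ)).symm
    refine ⟨G₀.biUnion id, ih hG₀ hPD.1 ((Finset.card_le_card ?_).trans hb), Y,
      hG (Finset.mem_insert_self _ _), hd, ?_, ?_⟩
    · exact Finset.subset_union_right
    · rwa [Finset.union_comm]
    · rw [Finset.union_comm]; rfl

/-- The dynamic programme computes exactly the unions of at most `t` pairwise disjoint sets of
`𝓓` of size at most `b`. [cite: Pratt2024SCC, Cor. 1.10 (proof)] -/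
theorem exists_mem_disjointUnions_iff {D : Finset (Finset α)} {b t : ℕ} {A : Finset α} :
    (∃ m ≤ t, A ∈ disjointUnions D b m) ↔
      ∃ G ⊆ D, G.card ≤ t ∧ (G : Set (Finset α)).PairwiseDisjoint id ∧ G.biUnion id = A ∧
        A.card ≤ b := by
  constructor
  · rintro ⟨m, hm, hA⟩
    obtain ⟨G, hG, hcard, hPD, hU⟩ := exists_family_of_mem_disjointUnions hA
    exact ⟨G, hG, hcard.trans hm, hPD, hU, card_le_of_mem_disjointUnions hA⟩
  · rintro ⟨G, hG, hcard, hPD, rfl, hb⟩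
    exact ⟨G.card, hcard, biUnion_mem_disjointUnions hG hPD hb⟩

/-! ## Balanced tricolouring of a partition into sets of size `≤ s` -/

/-- The union of the parts of colour `i` under a colouring `f` of a family `𝓟` by three
colours (`⊔_{a ∈ A} X_a` for the colour class `A`). [cite: Pratt2024SCC, Cor. 1.10 (proof)] -/
def colourClass (P : Finset (Finset α)) (f : Finset α → Fin 3) (i : Fin 3) : Finset α :=
  (P.filter fun X => f X = i).biUnion id

/-- Distinct colour classes of a pairwise disjoint family are disjoint. [folklore] -/
theorem disjoint_colourClass {P : Finset (Finset α)}
    (hPD : (P : Set (Finset α)).PairwiseDisjoint id) (f : Finset α → Fin 3) {i j : Fin 3}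
    (hij : i ≠ j) :
    Disjoint (colourClass P f i) (colourClass P f j) := by
  unfold colourClass
  rw [Finset.disjoint_biUnion_left]
  intro Z hZ
  rw [Finset.disjoint_biUnion_right]
  intro W hW
  simp only [Finset.mem_filter] at hZ hW
  have hne : Z ≠ W := fun h => hij (hZ.2 ▸ hW.2 ▸ congrArg f h)
  exact hPD (Finset.mem_coe.2 hZ.1) (Finset.mem_coe.2 hW.1) hne

/-- The colour classes exhaust the union of the family. [folklore] -/
theorem biUnion_colourClass (P : Finset (Finset α)) (f : Finset α → Fin 3) :
    Finset.univ.biUnion (colourClass P f) = P.biUnion id := by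
  unfold colourClass
  rw [← Finset.biUnion_biUnion, Finset.biUnion_filter_eq_of_maps_to fun _ _ => Finset.mem_univ _]

/-- The sizes of the three colour classes add up to the size of the union. [folklore] -/
theorem sum_card_colourClass {P : Finset (Finset α)}
    (hPD : (P : Set (Finset α)).PairwiseDisjoint id) (f : Finset α → Fin 3) :
    ∑ i, (colourClass P f i).card = (P.biUnion id).card := by
  rw [← biUnion_colourClass P f, Finset.card_biUnion]
  exact fun i _ j _ hij => disjoint_colourClass hPD f hij

/-- Greedy balancing: putting each part (of size `≤ s`) into a currently smallest colour class
keeps all three classes within `s` of each other. [folklore] -/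
theorem exists_colouring_card_le_card_add {P : Finset (Finset α)} {s : ℕ}
    (hPD : (P : Set (Finset α)).PairwiseDisjoint id) (hs : ∀ X ∈ P, X.card ≤ s) :
    ∃ f : Finset α → Fin 3, ∀ i j, (colourClass P f i).card ≤ (colourClass P f j).card + s := by
  induction P using Finset.induction_on with
  | empty => exact ⟨fun _ => 0, fun i j => by simp [colourClass]⟩
  | insert X P₀ hX ih =>
    have hPD₀ : (P₀ : Set (Finset α)).PairwiseDisjoint id :=
      hPD.subset (Finset.coe_subset.2 (Finset.subset_insert _ _))
    obtain ⟨f₀, hf₀⟩ := ih hPD₀ fun Y hY => hs Y (Finset.mem_insert_of_mem hY)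
    obtain ⟨i₀, -, hi₀⟩ := Finset.exists_min_image Finset.univ
      (fun i => (colourClass P₀ f₀ i).card) Finset.univ_nonempty
    refine ⟨Function.update f₀ X i₀, ?_⟩
    have hdisj : Disjoint X (P₀.biUnion id) := by
      rw [Finset.disjoint_biUnion_right]
      intro Z hZ
      have hne : X ≠ Z := fun h => hX (h ▸ hZ)
      exact hPD (Finset.mem_coe.2 (Finset.mem_insert_self _ _))
        (Finset.mem_coe.2 (Finset.mem_insert_of_mem hZ)) hne
    have hcard : ∀ i, (colourClass (insert X P₀) (Function.update f₀ X i₀) i).card =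
        (if i₀ = i then X.card else 0) + (colourClass P₀ f₀ i).card := by
      intro i
      have hfilt : (P₀.filter fun Y => Function.update f₀ X i₀ Y = i) =
          P₀.filter fun Y => f₀ Y = i :=
        Finset.filter_congr fun Y hY => by
          have hne : Y ≠ X := fun h => hX (h ▸ hY)
          rw [Function.update_of_ne hne]
      unfold colourClass
      rw [Finset.filter_insert, Function.update_self, hfilt]
      split_ifs with h
      · rw [Finset.biUnion_insert, Finset.card_union_of_disjoint]
        · rfl
        · exact hdisj.mono_right
            (Finset.biUnion_subset_biUnion_of_subset_left _ (Finset.filter_subset _ _))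
      · rw [Nat.zero_add]
    intro i j
    rw [hcard i, hcard j]
    have hXs := hs X (Finset.mem_insert_self _ _)
    have h1 := hf₀ i j
    have h2 := hi₀ j (Finset.mem_univ _)
    have h3 := hf₀ i i₀
    rcases eq_or_ne i₀ i with rfl | hi <;> rcases eq_or_ne i₀ j with rfl | hj
    · rw [if_pos rfl]
      omega
    · rw [if_pos rfl, if_neg hj]
      omega
    · rw [if_neg hi, if_pos rfl]
      omega
    · rw [if_neg hi, if_neg hj]
      omega

/-- **Balanced tricolouring** (Pratt, proof of Cor. 1.10: "for any partition
`X_1 ⊔ ⋯ ⊔ X_m = [n]` with `|X_i| ≤ s`, there exists a partition `A ⊔ B ⊔ C = [m]` such that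
`⌊n/3⌋ − s ≤ |⊔_{a ∈ A} X_a| ≤ ⌊n/3⌋ + s`, and similarly with the sets indexed by `B` and `C`"),
for `n = 3q`: some colouring has all three classes of size in `[q − s, q + s]` (the lower bound
written additively). [cite: Pratt2024SCC, Cor. 1.10 (proof)] -/
theorem exists_balanced_colouring {P : Finset (Finset α)} {s q : ℕ}
    (hPD : (P : Set (Finset α)).PairwiseDisjoint id) (hs : ∀ X ∈ P, X.card ≤ s)
    (hq : (P.biUnion id).card = 3 * q) :
    ∃ f : Finset α → Fin 3, ∀ i,
      q ≤ (colourClass P f i).card + s ∧ (colourClass P f i).card ≤ q + s := by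
  obtain ⟨f, hf⟩ := exists_colouring_card_le_card_add hPD hs
  refine ⟨f, fun i => ?_⟩
  have hsum := sum_card_colourClass hPD f
  rw [hq, Fin.sum_univ_three] at hsum
  have h0 := hf i 0
  have h1 := hf i 1
  have h2 := hf i 2
  have h0' := hf 0 i
  have h1' := hf 1 i
  have h2' := hf 2 i
  omega

/-! ## Guessing the boundary: from three balanced classes to a balanced tripartition -/

/-- Pratt's families `𝓕'_m`: the members of layer `m` of the dynamic programme over the downward
closure with the size bound `q + s`, of size at least `q − s` ("Next remove from the resulting set
family all sets of size less than `⌊n/3⌋ − s`. Let `𝓕'_1, …, 𝓕'_t` be the resulting set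
families"). [cite: Pratt2024SCC, Cor. 1.10 (proof)] -/
def prattLayer (F : Finset (Finset α)) (q s m : ℕ) : Finset (Finset α) :=
  (disjointUnions (downwardClosure F) (q + s) m).filter fun A => q ≤ A.card + s

/-- Pratt's families `𝓕''_{m,S} = {X ∖ S_i : X ∈ 𝓕'_m, |X| = c + |S_i|, X ∩ S = S_i}` for a
boundary set `S ⊇ S_i` and target size `c` (`= n/3 − s`). [cite: Pratt2024SCC, Cor. 1.10 (proof)] -/
def boundaryFamily (L : Finset (Finset α)) (S B : Finset α) (c : ℕ) : Finset (Finset α) :=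
  (L.filter fun X => X ∩ S = B ∧ X.card = c + B.card).image fun X => X \ B

/-- Membership in `boundaryFamily`. [folklore] -/
theorem mem_boundaryFamily {L : Finset (Finset α)} {S B : Finset α} {c : ℕ} {Y : Finset α} :
    Y ∈ boundaryFamily L S B c ↔ ∃ X ∈ L, X ∩ S = B ∧ X.card = c + B.card ∧ X \ B = Y := by
  simp only [boundaryFamily, Finset.mem_image, Finset.mem_filter]
  constructor
  · rintro ⟨X, ⟨hX, hXS, hXc⟩, rfl⟩
    exact ⟨X, hX, hXS, hXc, rfl⟩
  · rintro ⟨X, hX, hXS, hXc, rfl⟩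
    exact ⟨X, ⟨hX, hXS, hXc⟩, rfl⟩

/-- Every member of `𝓕''_{m,S}` has exactly `c` elements ("The sets `𝓕''_{t_i,S}` have equal size
`⌊n/3⌋ − s` by construction"). [cite: Pratt2024SCC, Cor. 1.10 (proof)] -/
theorem card_of_mem_boundaryFamily {L : Finset (Finset α)} {S B : Finset α} {c : ℕ} {Y : Finset α}
    (hY : Y ∈ boundaryFamily L S B c) : Y.card = c := by
  obtain ⟨X, -, hXS, hXc, rfl⟩ := mem_boundaryFamily.1 hY
  have hBX : B ⊆ X := hXS ▸ Finset.inter_subset_left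
  rw [Finset.card_sdiff_of_subset hBX, hXc]
  omega

/-- Every member of `𝓕''_{m,S}` lies in the universe `U ∖ S` of the sub-instance.
[cite: Pratt2024SCC, Cor. 1.10 (proof)] -/
theorem subset_sdiff_of_mem_boundaryFamily {L : Finset (Finset α)} {U S B : Finset α} {c : ℕ}
    (hL : ∀ X ∈ L, X ⊆ U) {Y : Finset α} (hY : Y ∈ boundaryFamily L S B c) : Y ⊆ U \ S := by
  obtain ⟨X, hX, hXS, -, rfl⟩ := mem_boundaryFamily.1 hY
  intro y hy
  rw [Finset.mem_sdiff] at hy ⊢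
  refine ⟨hL X hX hy.1, fun hyS => hy.2 ?_⟩
  rw [← hXS]
  exact Finset.mem_inter.2 ⟨hy.1, hyS⟩

/-- Members of `prattLayer F q s m` are subsets of the ground set. [folklore] -/
theorem subset_of_mem_prattLayer {F : Finset (Finset α)} {U : Finset α} (hF : F ⊆ U.powerset)
    {q s m : ℕ} {A : Finset α} (hA : A ∈ prattLayer F q s m) : A ⊆ U :=
  subset_of_mem_disjointUnions (downwardClosure_subset_powerset hF) (Finset.mem_filter.1 hA).1

/-- **The reduction, machine-free form** (Pratt, proof of Cor. 1.10). For a family `𝓕` of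
`≤ s`-subsets of a `3q`-element ground set `U` (`s ≤ q`) and a budget `t`: at most `t` sets of `𝓕`
cover `U` iff for some `t₀ + t₁ + t₂ ≤ t`, some `3s`-element `S ⊆ U` split as
`S = S₀ ⊔ S₁ ⊔ S₂`, the three families `𝓕''_{t_i,S}` (all of whose members are `(q − s)`-subsets
of the `3(q − s)`-element set `U ∖ S`, `card_of_mem_boundaryFamily`,
`subset_sdiff_of_mem_boundaryFamily`) contain a balanced tripartition of `U ∖ S` ("If there were
sets in `𝓕'_{t_1}, 𝓕'_{t_2}, 𝓕'_{t_3}` partitioning `[n]`, then there exists an `S` such that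
`𝓕''_{t_1,S}, 𝓕''_{t_2,S}, 𝓕''_{t_3,S}` contains a balanced tripartition of `[n] ∖ S`, and
conversely"). [cite: Pratt2024SCC, Cor. 1.10 (proof)] -/
theorem exists_cover_iff_exists_boundary_tripartition {F : Finset (Finset α)} {U : Finset α}
    {s q : ℕ} (hF : F ⊆ U.powerset) (hs : ∀ X ∈ F, X.card ≤ s) (hU : U.card = 3 * q)
    (hsq : s ≤ q) (t : ℕ) :
    (∃ G ⊆ F, G.card ≤ t ∧ U ⊆ G.biUnion id) ↔
      ∃ m : Fin 3 → ℕ, m 0 + m 1 + m 2 ≤ t ∧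
      ∃ S ⊆ U, S.card = 3 * s ∧
      ∃ B : Fin 3 → Finset α, (∀ i j, i ≠ j → Disjoint (B i) (B j)) ∧ Finset.univ.biUnion B = S ∧
      ∃ Y : Fin 3 → Finset α,
        (∀ i, Y i ∈ boundaryFamily (prattLayer F q s (m i)) S (B i) (q - s)) ∧
        (∀ i j, i ≠ j → Disjoint (Y i) (Y j)) ∧ Finset.univ.biUnion Y = U \ S := by
  constructor
  · intro hcov
    obtain ⟨G, hGD, hGt, hPD, hGU⟩ := (exists_cover_iff_exists_partition hF t).1 hcov
    have hDs : ∀ Z ∈ G, Z.card ≤ s := fun Z hZ => card_le_of_mem_downwardClosure hs (hGD hZ)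
    have hGU' : (G.biUnion id).card = 3 * q := by rw [hGU, hU]
    obtain ⟨f, hf⟩ := exists_balanced_colouring hPD hDs hGU'
    set X : Fin 3 → Finset α := colourClass G f with hX_def
    have hXdisj : ∀ i j, i ≠ j → Disjoint (X i) (X j) := fun i j hij =>
      disjoint_colourClass hPD f hij
    have hXU : Finset.univ.biUnion X = U := by rw [hX_def, biUnion_colourClass, hGU]
    have hXsub : ∀ i, X i ⊆ U := fun i =>
      hXU ▸ Finset.subset_biUnion_of_mem X (Finset.mem_univ i)
    have hXlayer : ∀ i, X i ∈ prattLayer F q s (G.filter fun Z => f Z = i).card := fun i =>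
      Finset.mem_filter.2 ⟨biUnion_mem_disjointUnions ((Finset.filter_subset _ _).trans hGD)
        (hPD.subset (Finset.coe_subset.2 (Finset.filter_subset _ _))) (hf i).2, (hf i).1⟩
    have hsumX : (X 0).card + (X 1).card + (X 2).card = 3 * q := by
      have h := sum_card_colourClass hPD f
      rwa [Fin.sum_univ_three, hGU'] at h
    have hB : ∀ i, ∃ Bi ⊆ X i, Bi.card = (X i).card - (q - s) := fun i =>
      Finset.exists_subset_card_eq (Nat.sub_le _ _)
    choose B hBX hBcard using hB
    have hBdisj : ∀ i j, i ≠ j → Disjoint (B i) (B j) := fun i j hij =>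
      (hXdisj i j hij).mono (hBX i) (hBX j)
    -- an element of `X i` lies in no `B j`, `j ≠ i`
    have hXB : ∀ i j x, x ∈ X i → x ∈ B j → j = i := by
      intro i j x hxX hxB
      by_contra hji
      exact Finset.disjoint_left.1 (hXdisj j i hji) (hBX j hxB) hxX
    refine ⟨fun i => (G.filter fun Z => f Z = i).card, ?_, Finset.univ.biUnion B, ?_, ?_, B, hBdisj,
      rfl, fun i => X i \ B i, ?_, ?_, ?_⟩
    · have hfib := Finset.card_eq_sum_card_fiberwise (f := f) (s := G) (t := Finset.univ)
        fun _ _ => Finset.mem_coe.2 (Finset.mem_univ _)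
      rw [Fin.sum_univ_three] at hfib
      dsimp only
      omega
    · exact Finset.biUnion_subset.2 fun i _ => (hBX i).trans (hXsub i)
    · rw [Finset.card_biUnion fun i _ j _ hij => hBdisj i j hij, Fin.sum_univ_three, hBcard, hBcard,
        hBcard]
      have h0 := (hf 0).1
      have h1 := (hf 1).1
      have h2 := (hf 2).1
      omega
    · intro i
      rw [mem_boundaryFamily]
      refine ⟨X i, hXlayer i, ?_, ?_, rfl⟩
      · ext x
        simp only [Finset.mem_inter, Finset.mem_biUnion, Finset.mem_univ, true_and]
        constructor
        · rintro ⟨hxX, j, hxB⟩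
          obtain rfl := hXB i j x hxX hxB
          exact hxB
        · exact fun hx => ⟨hBX i hx, i, hx⟩
      · have h1 := hBcard i
        have h2 := (hf i).1
        omega
    · exact fun i j hij => (hXdisj i j hij).mono Finset.sdiff_subset Finset.sdiff_subset
    · ext x
      simp only [Finset.mem_biUnion, Finset.mem_univ, true_and, Finset.mem_sdiff, not_exists]
      constructor
      · rintro ⟨i, hxX, hxB⟩
        refine ⟨hXsub i hxX, fun j hxBj => ?_⟩
        obtain rfl := hXB i j x hxX hxBj
        exact hxB hxBj
      · rintro ⟨hxU, hxS⟩
        have hx : x ∈ Finset.univ.biUnion X := hXU.symm ▸ hxU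
        obtain ⟨i, -, hxX⟩ := Finset.mem_biUnion.1 hx
        exact ⟨i, hxX, hxS i⟩
  · rintro ⟨m, hm, S, hSU, -, B, hBdisj, hBS, Y, hY, hYdisj, hYU⟩
    have hY' : ∀ i, ∃ X ∈ prattLayer F q s (m i),
        X ∩ S = B i ∧ X.card = (q - s) + (B i).card ∧ X \ B i = Y i :=
      fun i => mem_boundaryFamily.1 (hY i)
    choose X hXL hXS hXcard hXY using hY'
    have hBXi : ∀ i, B i ⊆ X i := fun i => (hXS i) ▸ Finset.inter_subset_left
    have hXeq : ∀ i, X i = Y i ∪ B i := fun i => by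
      rw [← hXY i, Finset.sdiff_union_of_subset (hBXi i)]
    have hYsub : ∀ i, Y i ⊆ U \ S := fun i =>
      hYU ▸ Finset.subset_biUnion_of_mem Y (Finset.mem_univ i)
    have hBsub : ∀ i, B i ⊆ S := fun i => hBS ▸ Finset.subset_biUnion_of_mem B (Finset.mem_univ i)
    have hXdisj : ∀ i j, i ≠ j → Disjoint (X i) (X j) := by
      intro i j hij
      rw [hXeq i, hXeq j, Finset.disjoint_union_left, Finset.disjoint_union_right,
        Finset.disjoint_union_right]
      exact ⟨⟨hYdisj i j hij, Finset.sdiff_disjoint.mono (hYsub i) (hBsub j)⟩,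
        Finset.disjoint_sdiff.mono (hBsub i) (hYsub j), hBdisj i j hij⟩
    have hXU : Finset.univ.biUnion X = U := by
      have h : Finset.univ.biUnion X = Finset.univ.biUnion Y ∪ Finset.univ.biUnion B := by
        rw [← Finset.biUnion_union]
        exact Finset.biUnion_congr rfl fun i _ => hXeq i
      rw [h, hYU, hBS, Finset.sdiff_union_of_subset hSU]
    have hG : ∀ i, ∃ Gi ⊆ downwardClosure F, Gi.card ≤ m i ∧
        (Gi : Set (Finset α)).PairwiseDisjoint id ∧ Gi.biUnion id = X i :=
      fun i => exists_family_of_mem_disjointUnions (Finset.mem_filter.1 (hXL i)).1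
    choose G hGD hGcard hGPD hGU using hG
    have hZX : ∀ i, ∀ Z ∈ G i, Z ⊆ X i := fun i Z hZ =>
      hGU i ▸ Finset.subset_biUnion_of_mem id hZ
    refine (exists_cover_iff_exists_partition hF t).2 ⟨Finset.univ.biUnion G, ?_, ?_, ?_, ?_⟩
    · exact Finset.biUnion_subset.2 fun i _ => hGD i
    · calc (Finset.univ.biUnion G).card ≤ ∑ i, (G i).card := Finset.card_biUnion_le
        _ ≤ ∑ i, m i := Finset.sum_le_sum fun i _ => hGcard i
        _ = m 0 + m 1 + m 2 := Fin.sum_univ_three m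
        _ ≤ t := hm
    · intro Z hZ W hW hne
      obtain ⟨i, -, hZi⟩ := Finset.mem_biUnion.1 (Finset.mem_coe.1 hZ)
      obtain ⟨j, -, hWj⟩ := Finset.mem_biUnion.1 (Finset.mem_coe.1 hW)
      by_cases hij : i = j
      · subst hij
        exact hGPD i (Finset.mem_coe.2 hZi) (Finset.mem_coe.2 hWj) hne
      · change Disjoint Z W
        exact (hXdisj i j hij).mono (hZX i Z hZi) (hZX j W hWj)
    · rw [Finset.biUnion_biUnion, ← hXU]
      exact Finset.biUnion_congr rfl fun i _ => hGU i

end Literature.Computability.FineGrained
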